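import Mathlib
import HarnessLib
import Summits.ValiantsHypothesis.ValiantsHypothesis.Theses.MonotoneRestoration
import Literature.Computability.AlgebraicComplexity.ArithCircuit
import Literature.Computability.AlgebraicComplexity.ArithCircuitProofs
import Literature.Computability.AlgebraicComplexity.ArithCircuitVarsCount
import Literature.Computability.AlgebraicComplexity.MonotoneStructure
import Literature.Computability.AlgebraicComplexity.PermanentIrreducible
import Literature.ModelTheory.FiniteModelTheory.CkEquiv
import Summits.ValiantsHypothesis.ValiantsHypothesis.Theorems.MonotoneRestorationMonotoneRestorationQPCosetCount
import Summits.ValiantsHypothesis.ValiantsHypothesis.Theorems.MonotoneRestorationMonotoneRestorationQPSymmetricLB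
import Summits.ValiantsHypothesis.ValiantsHypothesis.Theorems.MonotoneRestorationMonotoneRestorationQPSupportSymmetrisation
import Summits.ValiantsHypothesis.ValiantsHypothesis.Theorems.MonotoneRestorationMonotoneRestorationQPSparseRegime
import Summits.ValiantsHypothesis.ValiantsHypothesis.Theorems.MonotoneRestorationMonotoneRestorationQPBeta
import Literature.Computability.AlgebraicComplexity.SymmetricArithCircuit
import Literature.Computability.AlgebraicComplexity.DawarWilsenach2025Proofs
import Literature.GroupTheory.PermutationGroups.SmallIndexSubgroups
import Summits.ValiantsHypothesis.ValiantsHypothesis.Theorems.MonotoneRestorationQP.Negative.LoadBearing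
import Summits.ValiantsHypothesis.ValiantsHypothesis.Theorems.MonotoneRestorationMonotoneRestorationQPPermSupportCount

/-! TTRL-lite variant V19234 of stmt-ValiantsHypothesis-15886

Target `stub_esymmRowSums_complexity`, move `lemma_proposal` (the variable-counting lower-bound
tool of the boundary): over ANY commutative semiring `R` and ANY variable type `σ`, a polynomial
`f` mentions at most `2 · complexity f + 1` variables — a size-optimal fan-in-two circuit
(`ArithCircuit.exists_computes_size_eq_complexity`) has `complexity f` gates, each gate reads at
most two operands (so at most `2 · size` variables enter through gates) and the output operand may
be one more variable.  This is exactly the tree's Literature theorem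
`Literature.Computability.AlgebraicComplexity.card_vars_le_complexity`
(`ArithCircuitVarsCount.lean`), whose `[DecidableEq σ]` instance is supplied classically
(`MvPolynomial.vars` does not depend on the instance).
-/

-- `Summit.ValiantsHypothesis.ValiantsHypothesis.…` is the tree's mandated single-conjunct layout
-- (Sub = Summit), so the duplicated namespace component is intended.
set_option linter.dupNamespace false

namespace Summit.ValiantsHypothesis.ValiantsHypothesis.Theorems

open Summit.ValiantsHypothesis.ValiantsHypothesis.Theses.MonotoneRestoration
open Literature.Computability.AlgebraicComplexity

/-- **TTRL-lite variant V19234 of `stub_esymmRowSums_complexity`** (variable-counting floor).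
For every commutative semiring `R`, every variable type `σ` and every `f : MvPolynomial σ R`,
`#vars(f) ≤ 2 · complexity f + 1`: a fan-in-two circuit of size `s` computing `f` mentions at most
`2s` variables in its gates and at most one more in its output operand, and `complexity f` is
attained by such a circuit.  Immediate from the Literature theorem `card_vars_le_complexity`.
[cite: Burgisser2000, Def. 2.1 / Rem. 2.2] -/
theorem stub_esymmRowSums_complexity_var19234 :
    ∀ (R σ : Type) [CommSemiring R] (f : MvPolynomial σ R),
      f.vars.card ≤ 2 * complexity f + 1 := by
  intro R σ _ f
  classical
  exact card_vars_le_complexity f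

end Summit.ValiantsHypothesis.ValiantsHypothesis.Theorems
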